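import Literature.Geometry.Kaehler.HolomorphicChainBlowUpLelong
import Literature.Geometry.Kaehler.HolomorphicChainFactsProofs
import Literature.Geometry.Kaehler.ComplexFrameOrientation
import Literature.Geometry.Kaehler.LelongTheorem
import Literature.Geometry.GeometricMeasureTheory.PushforwardCurrent
import HarnessLib

/-!
# Blow-ups of a holomorphic chain at a regular point as chart integrals

Let `T` be a holomorphic `p`-chain on `Ω ⊆ V`, `b` a point of its carrier, and
`Ψ : ball 0 ρ ⊆ K → V` a normalised holomorphic chart at `b`
(`HolomorphicChain.exists_normalChart`: `K = T_b|T|`, `π₁ ∘ (Ψ − b) = id`, `DΨ(0) = ι`). The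
**blow-up chart** `g_r(k) = r⁻¹ (Ψ(r k) − b)` parametrises the carrier of the blow-up
`D_r = (A_{b,r})_# [T] ⌞ B(0,1)` (`HolomorphicChain.blowUp`): for small `r`,

* `blowUp_carrier_eq_image_chart` : `A⁻¹(reg|T|) ∩ B(0,1) = g_r(Q_r)`,
  `Q_r = {k ∈ ball 0 (ρ/r) | g_r k ∈ B(0,1)}`;
* `ae_density_blowUp_eq` : the density `θ_T(b + r y)` is a.e. equal to the constant `k₀` on it;
* `frameVector_orientationFrame_chart_eq` : the orientation `2p`-vector `ξ_T(Ψ k)` is the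
  Gram–Schmidt `2p`-vector of `(DΨ(k) e₁, …, DΨ(k) e_{2p})` for the real frame `e` of a unitary
  basis of `K` (canonical complex orientation, `ComplexFrameOrientation.lean`, `FrameVectorDet.lean`);
* `blowUp_apply_eq_chart_integral` : **`D_r(φ) = k₀ ∫_{Q_r} φ(g_r k)(DΨ(r k) e₁, …, DΨ(r k) e_{2p}) dk`**
  for every test `2p`-form `φ` on the unit ball (area formula for `2p`-vector fields,
  `PushforwardCurrent.setIntegral_image_apply_frame_eq`).

## References

* H. Federer, *Geometric Measure Theory*, Springer 1969, 4.3.18, 4.1.28, 3.2.5 [Federer1969].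
* R. Harvey, *Holomorphic chains and their boundaries*, PSPUM XXX.1 (1977), §1.4, Thm. 1.31 [Harvey1977].
-/

noncomputable section

open scoped Manifold Topology ENNReal NNReal InnerProductSpace
open Set Filter MeasureTheory Metric Function Module TopologicalSpace InnerProductSpace

namespace Literature.Geometry.Kaehler

open Literature.Geometry.GeometricMeasureTheory

-- Nested operator-norm instances on `Covector V m`, as in `Currents.lean`.
set_option maxSynthPendingDepth 2

universe u

/-! ### The real frame of a unitary basis -/

section RealFrame

variable {K : Type*} [NormedAddCommGroup K] [InnerProductSpace ℂ K] [FiniteDimensional ℂ K] {p : ℕ}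

/-- **The real orthonormal basis `(b₀, I b₀, …)` of a complex `p`-space** with unitary basis `b`.
[folklore] -/
theorem exists_orthonormalBasis_coe_eq_complexFrame (b : OrthonormalBasis (Fin p) ℂ K) :
    letI : InnerProductSpace ℝ K := InnerProductSpace.complexToReal
    ∃ e : OrthonormalBasis (Fin (2 * p)) ℝ K, ⇑e = complexFrame ⇑b := by
  letI iK : InnerProductSpace ℝ K := InnerProductSpace.complexToReal
  have hon : Orthonormal ℝ (complexFrame ⇑b) := orthonormal_complexFrame b.orthonormal
  have hp : finrank ℂ K = p := by
    rw [finrank_eq_card_basis b.toBasis, Fintype.card_fin]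
  have hcard : Fintype.card (Fin (2 * p)) = finrank ℝ K := by
    rw [Fintype.card_fin, finrank_real_of_complex, hp]
  cases p with
  | zero =>
    refine ⟨(stdOrthonormalBasis ℝ K).reindex (finCongr ?_), ?_⟩
    · rw [← hcard, Fintype.card_fin]
    · funext i
      exact Fin.elim0 (Fin.cast (by norm_num) i)
  | succ q =>
    refine ⟨(basisOfOrthonormalOfCardEqFinrank hon hcard).toOrthonormalBasis ?_, ?_⟩
    · rw [coe_basisOfOrthonormalOfCardEqFinrank]
      exact hon
    · rw [Basis.coe_toOrthonormalBasis, coe_basisOfOrthonormalOfCardEqFinrank]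

end RealFrame

/-! ### The blow-up chart -/

section Chart

variable {V : Type u} [NormedAddCommGroup V] [InnerProductSpace ℂ V] {K : Submodule ℂ V}

/-- The blow-up chart `g_r(k) = r⁻¹ • (Ψ(r k) − b)`. [cite: Federer1969, 4.3.18] -/
def blowUpChart (Ψ : K → V) (b : V) (r : ℝ) : K → V := fun k => r⁻¹ • (Ψ ((r : ℝ) • k) - b)

/-- Unfolding the blow-up chart. [folklore] -/
@[simp] theorem blowUpChart_apply (Ψ : K → V) (b : V) (r : ℝ) (k : K) :
    blowUpChart Ψ b r k = r⁻¹ • (Ψ ((r : ℝ) • k) - b) := rfl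

/-- `b + r • g_r(k) = Ψ(r k)`. [folklore] -/
theorem add_smul_blowUpChart (Ψ : K → V) (b : V) {r : ℝ} (hr : r ≠ 0) (k : K) :
    b + r • blowUpChart Ψ b r k = Ψ ((r : ℝ) • k) := by
  rw [blowUpChart_apply, smul_inv_smul₀ hr, add_sub_cancel]

/-- The real derivative of the blow-up chart: `Dg_r(k) = DΨ(r k)`. [folklore] -/
theorem hasFDerivAt_blowUpChart {Ψ : K → V} {ρ : ℝ} (hΨ : DifferentiableOn ℂ Ψ (ball 0 ρ)) (b : V)
    {r : ℝ} (hr : 0 < r) {k : K} (hk : (r : ℝ) • k ∈ ball (0 : K) ρ) :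
    HasFDerivAt (blowUpChart Ψ b r) ((fderiv ℂ Ψ ((r : ℝ) • k)).restrictScalars ℝ) k := by
  have h1 : HasFDerivAt Ψ ((fderiv ℂ Ψ ((r : ℝ) • k)).restrictScalars ℝ) ((r : ℝ) • k) :=
    ((hΨ.differentiableAt (isOpen_ball.mem_nhds hk)).hasFDerivAt).restrictScalars ℝ
  have h2 : HasFDerivAt (fun k' : K => (r : ℝ) • k') ((r : ℝ) • ContinuousLinearMap.id ℝ K) k :=
    (hasFDerivAt_id k).const_smul r
  have h3 := (h1.comp k h2).sub_const b
  have h4 := h3.const_smul r⁻¹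
  have heq : r⁻¹ • ((fderiv ℂ Ψ ((r : ℝ) • k)).restrictScalars ℝ).comp
      ((r : ℝ) • ContinuousLinearMap.id ℝ K) = (fderiv ℂ Ψ ((r : ℝ) • k)).restrictScalars ℝ := by
    ext v
    simp [smul_smul, inv_mul_cancel₀ hr.ne']
  exact h4.congr_fderiv heq

/-- The linear left inverse of the blow-up chart: `π₁ (g_r k) = k`. [folklore] -/
theorem apply_blowUpChart_eq (Ψ : K → V) (b : V) (π₁ : V →L[ℂ] K) {ρ : ℝ}
    (hleft : ∀ k ∈ ball (0 : K) ρ, π₁ (Ψ k - b) = k) {r : ℝ} (hr : 0 < r) {k : K}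
    (hk : (r : ℝ) • k ∈ ball (0 : K) ρ) : π₁ (blowUpChart Ψ b r k) = k := by
  rw [blowUpChart_apply, ← Complex.coe_smul, map_smul, hleft _ hk, Complex.coe_smul,
    inv_smul_smul₀ hr.ne']

/-- `r • k ∈ ball 0 ρ` iff `k ∈ ball 0 (ρ / r)`. [folklore] -/
theorem smul_mem_ball_zero_iff {r ρ : ℝ} (hr : 0 < r) (k : K) :
    (r : ℝ) • k ∈ ball (0 : K) ρ ↔ k ∈ ball (0 : K) (ρ / r) := by
  rw [mem_ball_zero_iff, mem_ball_zero_iff, norm_smul, Real.norm_of_nonneg hr.le,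
    lt_div_iff₀ hr, mul_comm]

end Chart

/-! ### The blow-up of a chain through the chart -/

namespace HolomorphicChain

variable {V : Type u} [NormedAddCommGroup V] [InnerProductSpace ℂ V] [FiniteDimensional ℂ V]
  [MeasurableSpace V] [BorelSpace V] {Ω : Opens V} {p : ℕ}
  (T : HolomorphicChain 𝓘(ℂ, V) Ω p) {K : Submodule ℂ V} {π₁ : V →L[ℂ] K} {ρ : ℝ} {Ψ : K → V}
  {N : Set V} {b : V}

omit [FiniteDimensional ℂ V] [MeasurableSpace V] [BorelSpace V] in
/-- **The carrier of the blow-up is the image of the blow-up chart**: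
`A_{b,r}⁻¹(reg|T|) ∩ B(0,1) = g_r(Q_r)` once `ball b r` lies in the chart domain `N`.
[cite: Federer1969, 4.3.18] -/
theorem blowUp_carrier_eq_image_chart
    (hcar : ∀ k ∈ ball (0 : K) ρ, Ψ k ∈ T.carrier) (hcov : T.carrier ∩ N ⊆ Ψ '' ball 0 ρ)
    {r : ℝ} (hr : 0 < r) (hbr : ball b r ⊆ N) :
    (fun y : V => b + r • y) ⁻¹' T.carrier ∩ ball (0 : V) 1 =
      blowUpChart Ψ b r '' {k | k ∈ ball (0 : K) (ρ / r) ∧ blowUpChart Ψ b r k ∈ ball (0 : V) 1} := by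
  ext y
  constructor
  · rintro ⟨hy, hy1⟩
    have hyr : b + r • y ∈ ball b r := by
      rw [mem_ball, dist_eq_norm, add_sub_cancel_left, norm_smul, Real.norm_of_nonneg hr.le]
      rw [mem_ball_zero_iff] at hy1
      nlinarith
    obtain ⟨k', hk', hk'y⟩ := hcov ⟨hy, hbr hyr⟩
    have hk : (r : ℝ) • (r⁻¹ • k') = k' := smul_inv_smul₀ hr.ne' k'
    refine ⟨r⁻¹ • k', ⟨?_, ?_⟩, ?_⟩
    · rw [← smul_mem_ball_zero_iff hr, hk]
      exact hk'
    · rw [blowUpChart_apply, hk, hk'y, add_sub_cancel_left, inv_smul_smul₀ hr.ne']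
      exact hy1
    · rw [blowUpChart_apply, hk, hk'y, add_sub_cancel_left, inv_smul_smul₀ hr.ne']
  · rintro ⟨k, ⟨hk, hk1⟩, rfl⟩
    refine ⟨?_, hk1⟩
    show b + r • blowUpChart Ψ b r k ∈ T.carrier
    rw [add_smul_blowUpChart Ψ b hr.ne']
    exact hcar _ ((smul_mem_ball_zero_iff hr k).2 hk)

/-- **The density of the blow-up is a.e. the constant `k₀`** when `θ_T = k₀` a.e. on
`reg|T| ∩ N ⊇ reg|T| ∩ ball b r` (homotheties preserve `𝓗^{2p}`-null sets). [cite: Federer1969, 4.3.18] -/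
theorem ae_density_blowUp_eq {r : ℝ} (hr : 0 < r) (hbr : ball b r ⊆ N) {k₀ : ℤ}
    (hdens : ∀ᵐ y ∂((μHE[2 * p] : Measure V).restrict (T.carrier ∩ N)), T.density y = k₀) :
    ∀ᵐ y ∂((μHE[2 * p] : Measure V).restrict
      ((fun y : V => b + r • y) ⁻¹' T.carrier ∩ ball (0 : V) 1)), T.density (b + r • y) = k₀ := by
  set Bad : Set V := {z | T.density z ≠ k₀} ∩ (T.carrier ∩ N) with hBad
  have hmeas : MeasurableSet {z : V | T.density z ≠ k₀} :=
    (measurableSet_eq_fun T.measurable_density measurable_const).compl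
  have hBad0 : (μHE[2 * p] : Measure V) Bad = 0 := by
    have h := ae_iff.1 hdens
    rwa [Measure.restrict_apply hmeas] at h
  have hA : Measurable fun y : V => b + r • y := (measurable_const_smul r).const_add b
  have hpre : (μHE[2 * p] : Measure V) ((fun y : V => b + r • y) ⁻¹' Bad) = 0 := by
    rw [euclideanHausdorffMeasure_preimage_add_smul b hr Bad, hBad0, mul_zero]
  have hmeas' : MeasurableSet {y : V | T.density (b + r • y) ≠ k₀} :=
    (measurableSet_eq_fun (T.measurable_density.comp hA) measurable_const).compl
  rw [ae_iff, Measure.restrict_apply hmeas']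
  refine measure_mono_null ?_ hpre
  rintro y ⟨hy, hyc, hy1⟩
  refine ⟨hy, hyc, hbr ?_⟩
  rw [mem_ball, dist_eq_norm, add_sub_cancel_left, norm_smul, Real.norm_of_nonneg hr.le]
  rw [mem_ball_zero_iff] at hy1
  nlinarith

omit [FiniteDimensional ℂ V] [MeasurableSpace V] [BorelSpace V] in
/-- Differentiating the left-inverse relation `π₁ (Ψ k − b) = k` on the ball: `π₁ ∘ DΨ(k) = id`,
so `DΨ(k)` is injective. [folklore] -/
theorem injective_fderiv_chart (hΨ : DifferentiableOn ℂ Ψ (ball 0 ρ))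
    (hleft : ∀ k ∈ ball (0 : K) ρ, π₁ (Ψ k - b) = k) {k : K} (hk : k ∈ ball (0 : K) ρ) :
    Injective (fderiv ℂ Ψ k) := by
  have hB : ball (0 : K) ρ ∈ 𝓝 k := isOpen_ball.mem_nhds hk
  have h1 : HasFDerivAt (fun k' => π₁ (Ψ k' - b)) (π₁.comp (fderiv ℂ Ψ k)) k :=
    π₁.hasFDerivAt.comp k ((hΨ.differentiableAt hB).hasFDerivAt.sub_const b)
  have h2 : HasFDerivAt (fun k' => π₁ (Ψ k' - b)) (ContinuousLinearMap.id ℂ K) k :=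
    (hasFDerivAt_id k).congr_of_eventuallyEq (eventually_of_mem hB fun k' hk' => hleft k' hk')
  have hπD := h1.unique h2
  intro a c hac
  have ha := congrArg (fun f : K →L[ℂ] K => f a) hπD
  have hc := congrArg (fun f : K →L[ℂ] K => f c) hπD
  simp only [ContinuousLinearMap.comp_apply, ContinuousLinearMap.id_apply] at ha hc
  rw [← ha, ← hc]
  exact congrArg π₁ hac

/-- **The orientation of `[T]` along the chart is the Gram–Schmidt orientation of the chart**:
at `Ψ k` the orientation `2p`-vector `ξ_T` of `[T]` equals the `2p`-vector of the Gram–Schmidt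
orthonormalisation of `(DΨ(k) e₁, …, DΨ(k) e_{2p})`, `e = (b₀, I b₀, …)` the real frame of a
unitary basis `b` of `K` (both are the canonical orientation of the complex tangent plane
`im DΨ(k)`: `J · ξ_T = DΨ(k)_* e = J · GS`). [cite: Federer1969, 4.2.29, 3.2.1; Harvey1977, App. A.2] -/
theorem frameVector_orientationFrame_chart_eq (hKp : finrank ℂ K = p)
    (hΨ : DifferentiableOn ℂ Ψ (ball 0 ρ)) (hleft : ∀ k ∈ ball (0 : K) ρ, π₁ (Ψ k - b) = k)
    (htan : ∀ k ∈ ball (0 : K) ρ,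
      approxTangentCone (2 * p) ((μHE[2 * p] : Measure V).restrict T.carrier) (Ψ k) =
        Set.range (fderiv ℂ Ψ k))
    (bK : OrthonormalBasis (Fin p) ℂ K) {k : K} (hk : k ∈ ball (0 : K) ρ) :
    letI : InnerProductSpace ℝ V := InnerProductSpace.complexToReal
    letI : InnerProductSpace ℝ K := InnerProductSpace.complexToReal
    ∀ e : OrthonormalBasis (Fin (2 * p)) ℝ K, ⇑e = complexFrame ⇑bK →
      frameVector (T.orientationFrame (Ψ k)) =
        frameVector (gramSchmidtNormed ℝ fun j => ((fderiv ℂ Ψ k).restrictScalars ℝ) (e j)) := by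
  letI iV : InnerProductSpace ℝ V := InnerProductSpace.complexToReal
  letI iK : InnerProductSpace ℝ K := InnerProductSpace.complexToReal
  intro e he
  set D : K →L[ℂ] V := fderiv ℂ Ψ k with hD
  have hDinj : Injective D := injective_fderiv_chart hΨ hleft hk
  have hDinjR : Injective (D.restrictScalars ℝ) := hDinj
  have hrank : finrank ℂ (LinearMap.range (D : K →ₗ[ℂ] V)) = p := by
    rw [LinearMap.finrank_range_of_inj hDinj, hKp]
  obtain ⟨u', hu', hspan'⟩ :=
    exists_orthonormal_span_complexFrame_eq (LinearMap.range (D : K →ₗ[ℂ] V)) hrank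
  have hspanR : ((Submodule.span ℝ (Set.range (complexFrame u')) : Submodule ℝ V) : Set V) =
      Set.range D := hspan'.trans (LinearMap.coe_range _)
  have h1 : frameVector (T.orientationFrame (Ψ k)) = frameVector (complexFrame u') :=
    T.frameVector_orientationFrame hu' (by rw [htan k hk]; exact hspanR)
  have h2 : ∀ ω : Covector V (2 * p), ω (⇑D ∘ complexFrame ⇑bK) =
      ((D.restrictScalars ℝ : K →L[ℝ] V) : K →ₗ[ℝ] V).normDet * ω (complexFrame u') := fun ω =>
    apply_comp_complexFrame_eq_normDet_mul bK D hu' hspanR ω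
  have h3 : ∀ ω : Covector V (2 * p), ((D.restrictScalars ℝ : K →L[ℝ] V) : K →ₗ[ℝ] V).normDet *
      ω (gramSchmidtNormed ℝ fun j => (D.restrictScalars ℝ) (e j)) =
        ω fun j => (D.restrictScalars ℝ) (e j) := fun ω =>
    normDet_mul_apply_gramSchmidtNormed hDinjR e ω
  have hfun : (fun j => (D.restrictScalars ℝ) (e j)) = ⇑D ∘ complexFrame ⇑bK := by
    funext j
    simp [he]
  have hnd : ((D.restrictScalars ℝ : K →L[ℝ] V) : K →ₗ[ℝ] V).normDet ≠ 0 := fun h0 =>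
    (LinearMap.normDet_eq_zero_iff_ker_ne_bot.1 h0) (LinearMap.ker_eq_bot.2 hDinjR)
  rw [h1]
  ext ω
  simp only [frameVector_apply]
  refine mul_left_cancel₀ hnd ?_
  rw [← h2 ω, ← hfun, h3 ω]

open Literature.Analysis.Calculus in
/-- **The blow-up as a chart integral**: for `0 < r` with `closedBall b r ⊆ Ω`, `ball b r ⊆ N`,
`D_r(φ) = k₀ ∫_{Q_r} φ(g_r k)(DΨ(r k) e₁, …, DΨ(r k) e_{2p}) dk` for every test `2p`-form `φ` on
the unit ball, where `Q_r = {k ∈ ball 0 (ρ/r) | g_r k ∈ B(0,1)}` and `e` is the real frame of a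
unitary basis of `K` (area formula for `2p`-vector fields along the injective immersion `g_r`,
density `k₀` a.e., canonical orientation). [cite: Federer1969, 4.3.18, 3.2.5; Harvey1977, Thm. 1.31] -/
theorem blowUp_apply_eq_chart_integral (hKp : finrank ℂ K = p)
    (hΨ : DifferentiableOn ℂ Ψ (ball 0 ρ)) (hleft : ∀ k ∈ ball (0 : K) ρ, π₁ (Ψ k - b) = k)
    (hcar : ∀ k ∈ ball (0 : K) ρ, Ψ k ∈ T.carrier) (hcov : T.carrier ∩ N ⊆ Ψ '' ball 0 ρ)
    (htan : ∀ k ∈ ball (0 : K) ρ,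
      approxTangentCone (2 * p) ((μHE[2 * p] : Measure V).restrict T.carrier) (Ψ k) =
        Set.range (fderiv ℂ Ψ k))
    {k₀ : ℤ} (hdens : ∀ᵐ y ∂((μHE[2 * p] : Measure V).restrict (T.carrier ∩ N)), T.density y = k₀)
    (bK : OrthonormalBasis (Fin p) ℂ K) {r : ℝ} (hr : 0 < r) (hΩ : closedBall b r ⊆ (Ω : Set V))
    (hbr : ball b r ⊆ N) (φ : TestForm (unitBall V) (2 * p)) :
    letI : InnerProductSpace ℝ V := InnerProductSpace.complexToReal
    letI : InnerProductSpace ℝ K := InnerProductSpace.complexToReal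
    ∀ e : OrthonormalBasis (Fin (2 * p)) ℝ K, ⇑e = complexFrame ⇑bK →
      T.blowUp b r φ = (k₀ : ℝ) *
        ∫ k in {k | k ∈ ball (0 : K) (ρ / r) ∧ blowUpChart Ψ b r k ∈ ball (0 : V) 1},
          φ (blowUpChart Ψ b r k) fun j => (fderiv ℂ Ψ ((r : ℝ) • k)) (e j) := by
  letI iV : InnerProductSpace ℝ V := InnerProductSpace.complexToReal
  letI iK : InnerProductSpace ℝ K := InnerProductSpace.complexToReal
  intro e he
  set g := blowUpChart Ψ b r with hg
  set Q : Set K := {k | k ∈ ball (0 : K) (ρ / r) ∧ g k ∈ ball (0 : V) 1} with hQ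
  set S : Set V := (fun y : V => b + r • y) ⁻¹' T.carrier ∩ ball (0 : V) 1 with hS
  set g' : K → K →L[ℝ] V := fun k => (fderiv ℂ Ψ ((r : ℝ) • k)).restrictScalars ℝ with hg'
  have hrk : ∀ k ∈ Q, (r : ℝ) • k ∈ ball (0 : K) ρ := fun k hk => (smul_mem_ball_zero_iff hr k).2 hk.1
  have hgd : ∀ k ∈ Q, HasFDerivWithinAt g (g' k) Q k := fun k hk =>
    (hasFDerivAt_blowUpChart hΨ b hr (hrk k hk)).hasFDerivWithinAt
  have hginj : ∀ k ∈ Q, Injective (g' k) := fun k hk =>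
    injective_fderiv_chart hΨ hleft (hrk k hk)
  have hgi : InjOn g Q := fun a ha c hc h => by
    rw [← apply_blowUpChart_eq Ψ b π₁ hleft hr (hrk a ha), ← apply_blowUpChart_eq Ψ b π₁ hleft hr
      (hrk c hc)]
    exact congrArg π₁ h
  -- `Q` is open
  have hgc : ContinuousOn g (ball (0 : K) (ρ / r)) := fun k hk =>
    (hasFDerivAt_blowUpChart hΨ b hr ((smul_mem_ball_zero_iff hr k).2 hk)).continuousAt
      |>.continuousWithinAt
  have hQo : IsOpen Q :=
    hgc.isOpen_inter_preimage (t := ball (0 : V) 1) isOpen_ball isOpen_ball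
  have hQm : MeasurableSet Q := hQo.measurableSet
  -- the current of integration, unfolded
  have hSeq : S = g '' Q := T.blowUp_carrier_eq_image_chart hcar hcov hr hbr
  have hint := T.integrable_blowUp_data_of_lelong Lelong1957_hausdorffMeasure_inter_lt_top_holds hr hΩ
  have hli : LocallyIntegrableOn
      (fun y => ((T.density (b + r • y) : ℤ) : ℝ) • frameVector (T.orientationFrame (b + r • y)))
      (unitBall V : Set V) ((μHE[2 * p] : Measure V).restrict S) :=
    hint.locallyIntegrable.locallyIntegrableOn _
  show currentOfIntegration S (fun y => T.density (b + r • y))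
    (fun y => T.orientationFrame (b + r • y)) φ = _
  rw [currentOfIntegration_apply hli]
  -- the push-forward frame and the a.e. identity of the integrands
  obtain ⟨ξ, hξ, -⟩ := exists_frame_image (f := g) (f' := g') (s := Q) hgi e
  have hae : ∀ᵐ y ∂((μHE[2 * p] : Measure V).restrict S),
      ((T.density (b + r • y) : ℤ) : ℝ) * φ y (T.orientationFrame (b + r • y)) =
        (k₀ : ℝ) * φ y (ξ y) := by
    have hmem : ∀ᵐ y ∂((μHE[2 * p] : Measure V).restrict S), y ∈ S :=
      ae_restrict_mem ((T.measurableSet_carrier.preimage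
        ((measurable_const_smul r).const_add b)).inter measurableSet_ball)
    filter_upwards [T.ae_density_blowUp_eq hr hbr hdens, hmem] with y hy hyS
    rw [hy]
    congr 1
    rw [hSeq] at hyS
    obtain ⟨k, hk, rfl⟩ := hyS
    have hframe := T.frameVector_orientationFrame_chart_eq hKp hΨ hleft htan bK (hrk k hk) e he
    rw [add_smul_blowUpChart Ψ b hr.ne', ← frameVector_apply, hframe, frameVector_apply, hξ k hk]
  rw [integral_congr_ae hae, integral_const_mul, hSeq,
    setIntegral_image_apply_frame_eq hQm hgd hginj hgi e hξ (fun y => φ y)]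
  rfl

end HolomorphicChain

end Literature.Geometry.Kaehler
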